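import Summits.Ventures.CertifiedQuantumChemistry.Rows.GMatrixRelaxationKernel
import HarnessLib

/-!
# Ventures/CertifiedQuantumChemistry — Rows/MaximalSpinProjectionRelaxationKernel.lean: the PRINTED
# `S`-representability row (Mazziotti (98)) at maximal |M| = S, together with `G ⪰ 0`, FORCES the
# cell's E3 / E4 rows at every feasible point of the printed sector programme
# (rdm-A, addendum 18, theorem F3.3 — relaxation level; part 1 of 2: identities and kernels)

HONEST FRAMING (verbatim): certified bounds for a stated model Hamiltonian in a stated basis; not a
claim about the real molecule beyond that model.

Seat rdm-A (gen 57), zero compute; ROWS courtesy file (no row, no claim node, no certificate sentence,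
nothing asserted about any model; no instance, reader or FORMAT byte changes; generator-B independence
untouched — a tree theorem is not generator code). After `Rows/GMatrixRelaxationKernel.lean` (F3.2)
this is rdm-A's THEOREM F3.3 of `pub-qchem-rdm/FORMAT-qcl1-addendum-18-f3.md` §18.2 (there verified
in exact rational arithmetic on the `k = 4, 5, 6` layouts only), now for EVERY orbital set `Λ` and
every sector `(N_α, N_β) = (a, b)` of the PRINTED `S_z`-sector DQG programme `IsDQGFeasibleSector`,
with the value of Mazziotti's row (98), `X(Γ) := Σ_{xy} Γ^{xα,yβ}_{yα,xβ} = N/2 + M² − S(S+1)`, as an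
explicit hypothesis. Part 2 (`Rows/SingletRelaxationRowEquivalence.lean`) specialises to the typer's
singlet-restricted programme `IsDQGFeasibleSinglet n` (`Literature/…/SingletRestrictedRelaxation`,
where (98) at `S = M = 0` is built in): `γ_αα = γ_ββ`, feasible-set equalities, value / bound forms.

* §1 IDENTITIES (F3.1 at relaxation level; no positivity used). For ANY pair,
  `Σ_{pq} G_{(pβ,pα),(qβ,qα)} = Tr γ_ββ − Σ_{pq} Γ_{(pβ,qα),(qβ,pα)}` (`sum_gMap_downUp_eq`; the
  `⟨Ŝ_−Ŝ_+⟩`-form of Mazziotti's `G`-map, i.e. the cell's E3 functional of FORMAT-qcl1 §5) and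
  `Σ_{pq} G_{(pα,pβ),(qα,qβ)} = Tr γ_αα − Σ_{xy} Γ_{(xα,yβ),(yα,xβ)}` (`sum_gMap_upDown_eq`, the
  `⟨Ŝ_+Ŝ_−⟩`-form); fermionic antisymmetry identifies the first `Γ`-sum with the (98) functional
  `X(Γ) := Σ_{xy} Γ_{(xα,yβ),(yα,xβ)}` (`sum_exchange_downUp_eq`). Hence on the printed sector rows
  (`IsDQGFeasibleSector a b`): E3-form `= b − X`, flipped form `= a − X`
  (`sum_gMap_downUp_of_isDQGFeasibleSector`, `sum_gMap_upDown_of_isDQGFeasibleSector`), and if the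
  printed row (98) holds with its general value `X = N/2 + M² − S(S+1)` (`M = (a − b)/2`, ANY `S`),
  then `Σ_{pq} G_{(pβ,pα),(qβ,qα)} = S(S+1) − M(M+1)` and `Σ_{pq} G_{(pα,pβ),(qα,qβ)} = S(S+1) − M(M−1)`
  (`sum_gMap_downUp_of_sRow`, `sum_gMap_upDown_of_sRow`): print's row (98) IS the cell's E3 row, as an
  identity of linear functionals.
* §2 MAXIMAL PROJECTION, any sector (F3.3). If `M = S` the value of (98) is `N/2 + S² − S(S+1) = b`;
  so `IsDQGFeasibleSector a b γ Γ` + `X = b` give E3 `= 0`, then `G ⪰ 0` makes the indicator of the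
  members `(rβ, rα)` (the coefficient vector of `Ŝ_+`) a KERNEL vector of `G(γ, Γ)`:
  `Σ_r G_{m,(rβ,rα)} = 0` and `Σ_r G_{(rβ,rα),m} = 0` for every `m`
  (`sum_gMap_col_downUp_eq_zero_of_exchange_eq_numDown`, `sum_gMap_row_downUp_eq_zero_…`), whose
  `m = (pβ, qα)` components are the cell's E4a rows `γ_{pβ,qβ} = Σ_r Γ_{(pβ,rα),(rβ,qα)}`
  (`e4a_of_exchange_eq_numDown`, FORMAT-qcl1 §5 E4a `ω(a†_{pβ} a_{qα} Ŝ_+) = 0`) and whose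
  other components are the spin-flip sums `Σ_r Γ_{(P,rα),(rβ,qβ)} = 0` (`sum_two_flip_eq_zero_of_exchange_eq_numDown`, entries a
  two-body `S_z` selection rule would kill one by one). Mirror for `M = −S` (`X = a`, members
  `(rα, rβ)` = `Ŝ_−`, rows `γ_{pα,qα} = Σ_r Γ_{(rα,pβ),(qα,rβ)}` = FORMAT's E4b shape; `…_numUp`).

Relation to the tree. rdm-B's `Rows/MaximalSpinProjectionRows.lean` proves the rows at STATE level
(§1 there) and the abstract REDUNDANCY LEMMA (§2 there: `G ⪰ 0` + the E3 row in `G`-form ⇒ E4a;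
+ equal spin traces ⇒ E4b). Added here: the link to the PRINTED row — Mazziotti's (98) functional
`X(Γ)` — for every sector and every `S`, incl. the `M = −S` mirror (not an instance of the E3 `= 0`
hypothesis), in column AND row form. The PSD-kernel step (`Matrix.PosSemidef.dotProduct_mulVec_zero_iff`)
is re-derived for an arbitrary indicator family in five short private lemmas (rdm-B's helpers are
`private`; its file is not imported, no byte of it touched). Everything is PROVED (0 sorry, 0 def).
NOT here: `S > 0` with `|M| < S` (no kernel: the forms equal `S(S+1) − M(M±1) > 0`); the spin-ADAPTED
blocks `²D^{0,0}`, `²D^{1,m}` (Mazziotti (79)–(88), (99)–(103): spin adaptation enforces (98)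
automatically; the converse is NOT claimed); F3.4 (the row set without (16)); any pinned instance.

References: D. A. Mazziotti, *Variational two-electron reduced-density-matrix theory*, Adv. Chem.
Phys. 134 (Wiley, 2007) 21–59, §II.B eq. (15) (the `G`-map), §II.F.1 eqs. (96)–(98) (the
`S`-representability row; held volume `book:editornd-reduced-density-matrix-mechanics` pp. 50–51).
[cite: Mazziotti2007RDMChapter, §II.B eq. (15), §II.F.1 eqs. (96)-(98)]
FORMAT-qcl1 v0.3.0 §5 E3/E4 + REDUNDANCY LEMMA; maximal-spin-projection rows in v2RDM codes:
J. Fosso-Tande, T.-S. Nguyen, G. Gidofalvi, A. E. DePrince III, J. Chem. Theory Comput. 12 (2016) 2260.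
-/

noncomputable section

namespace Summit.Ventures.CertifiedQuantumChemistry

open Matrix Finset
open Literature.MathematicalPhysics.QuantumLattice Literature.MathematicalPhysics.QuantumChemistry
open scoped ComplexOrder

variable {Λ : Type*} [LinearOrder Λ] [Fintype Λ]

/-! ### A PSD matrix kills the indicator of every index family on which its form vanishes -/

section Kernel

/-- `(G w)_m = Σ_r G_{m, f r}` for the indicator `w` of the family `f`. [folklore] -/
private theorem mulVec_indicatorFamily_apply (G : Matrix (Orb Λ × Orb Λ) (Orb Λ × Orb Λ) ℂ)
    (f : Λ → Orb Λ × Orb Λ) (m : Orb Λ × Orb Λ) :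
    (G *ᵥ fun j => ∑ r : Λ, if j = f r then (1 : ℂ) else 0) m = ∑ r : Λ, G m (f r) := by
  simp only [mulVec, dotProduct, Finset.mul_sum, mul_ite, mul_one, mul_zero]
  rw [Finset.sum_comm]
  simp only [Finset.sum_ite_eq', Finset.mem_univ, if_true]

/-- The indicator of a family is a real vector. [folklore] -/
private theorem star_indicatorFamily (f : Λ → Orb Λ × Orb Λ) :
    star (fun j : Orb Λ × Orb Λ => ∑ r : Λ, if j = f r then (1 : ℂ) else 0) =
      fun j => ∑ r : Λ, if j = f r then (1 : ℂ) else 0 := by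
  funext j
  simp only [Pi.star_apply, star_sum, apply_ite (star : ℂ → ℂ), star_one, star_zero]

/-- `w† G w = Σ_{pq} G_{f p, f q}` for the indicator `w` of the family `f`. [folklore] -/
private theorem indicatorFamily_form (G : Matrix (Orb Λ × Orb Λ) (Orb Λ × Orb Λ) ℂ)
    (f : Λ → Orb Λ × Orb Λ) :
    star (fun j : Orb Λ × Orb Λ => ∑ r : Λ, if j = f r then (1 : ℂ) else 0) ⬝ᵥ
        (G *ᵥ fun j => ∑ r : Λ, if j = f r then (1 : ℂ) else 0) =
      ∑ p : Λ, ∑ q : Λ, G (f p) (f q) := by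
  rw [star_indicatorFamily, dotProduct]
  simp only [mulVec_indicatorFamily_apply, Finset.sum_mul, ite_mul, one_mul, zero_mul]
  rw [Finset.sum_comm]
  simp only [Finset.sum_ite_eq', Finset.mem_univ, if_true]

/-- **Kernel, column form.** If `G ⪰ 0` and `Σ_{pq} G_{f p, f q} = 0`, then `Σ_r G_{m, f r} = 0` for
every `m` (`G w = 0` for the indicator `w` of `f`). [folklore] -/
private theorem sum_apply_family_eq_zero {G : Matrix (Orb Λ × Orb Λ) (Orb Λ × Orb Λ) ℂ}
    (hG : G.PosSemidef) (f : Λ → Orb Λ × Orb Λ)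
    (h0 : ∑ p : Λ, ∑ q : Λ, G (f p) (f q) = 0) (m : Orb Λ × Orb Λ) :
    ∑ r : Λ, G m (f r) = 0 := by
  have hform := indicatorFamily_form G f
  rw [h0] at hform
  have hker := (hG.dotProduct_mulVec_zero_iff _).1 hform
  have hm := congr_fun hker m
  rwa [mulVec_indicatorFamily_apply, Pi.zero_apply] at hm

/-- **Kernel, row form.** Under the same hypotheses `Σ_r G_{f r, m} = 0` for every `m` (`G` is
Hermitian and the indicator is real: `w† G = 0`). [folklore] -/
private theorem sum_family_apply_eq_zero {G : Matrix (Orb Λ × Orb Λ) (Orb Λ × Orb Λ) ℂ}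
    (hG : G.PosSemidef) (f : Λ → Orb Λ × Orb Λ)
    (h0 : ∑ p : Λ, ∑ q : Λ, G (f p) (f q) = 0) (m : Orb Λ × Orb Λ) :
    ∑ r : Λ, G (f r) m = 0 := by
  calc ∑ r : Λ, G (f r) m = ∑ r : Λ, star (G m (f r)) :=
        Finset.sum_congr rfl fun r _ => (hG.isHermitian.apply (f r) m).symm
    _ = star (∑ r : Λ, G m (f r)) := (star_sum _ _).symm
    _ = 0 := by rw [sum_apply_family_eq_zero hG f h0 m, star_zero]

end Kernel

/-! ### §1 Identities: the `⟨Ŝ_−Ŝ_+⟩`- and `⟨Ŝ_+Ŝ_−⟩`-forms of `G(γ, Γ)` and Mazziotti's row (98) -/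

section Identities

variable (γ : Matrix (Orb Λ) (Orb Λ) ℂ) (Γ : Matrix (Orb Λ × Orb Λ) (Orb Λ × Orb Λ) ℂ)

/-- **The `⟨Ŝ_−Ŝ_+⟩`-form of the `G`-map** (the cell's E3 functional, FORMAT-qcl1 §5, in `G` entries):
for ANY pair, `Σ_{pq} G_{(pβ,pα),(qβ,qα)} = Tr γ_ββ − Σ_{pq} Γ_{(pβ,qα),(qβ,pα)}` (Mazziotti's eq. (15)
`G^{ij}_{kl} = δ_{jl} γ^i_k − Γ^{il}_{kj}` summed over the `Ŝ_+` members). -/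
theorem sum_gMap_downUp_eq :
    ∑ p : Λ, ∑ q : Λ, gMap γ Γ (orb p 1, orb p 0) (orb q 1, orb q 0) =
      ∑ x : Λ, γ (orb x 1) (orb x 1) -
        ∑ p : Λ, ∑ q : Λ, Γ (orb p 1, orb q 0) (orb q 1, orb p 0) := by
  simp only [gMap, orb_inj, and_true, Finset.sum_sub_distrib, Finset.sum_ite_eq, Finset.mem_univ,
    if_true]

/-- **The `⟨Ŝ_+Ŝ_−⟩`-form of the `G`-map**: for ANY pair,
`Σ_{pq} G_{(pα,pβ),(qα,qβ)} = Tr γ_αα − Σ_{xy} Γ_{(xα,yβ),(yα,xβ)}` — the `Γ`-sum being literally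
Mazziotti's `S`-representability functional of row (98). -/
theorem sum_gMap_upDown_eq :
    ∑ p : Λ, ∑ q : Λ, gMap γ Γ (orb p 0, orb p 1) (orb q 0, orb q 1) =
      ∑ x : Λ, γ (orb x 0) (orb x 0) -
        ∑ x : Λ, ∑ y : Λ, Γ (orb x 0, orb y 1) (orb y 0, orb x 1) := by
  simp only [gMap, orb_inj, and_true, Finset.sum_sub_distrib, Finset.sum_ite_eq, Finset.mem_univ,
    if_true]

variable {Γ} in
omit [LinearOrder Λ] in
/-- Fermionic antisymmetry in both index pairs identifies the `Γ`-sum of the `⟨Ŝ_−Ŝ_+⟩`-form with the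
row-(98) functional: `Σ_{pq} Γ_{(pβ,qα),(qβ,pα)} = Σ_{xy} Γ_{(xα,yβ),(yα,xβ)}`. -/
theorem sum_exchange_downUp_eq (hfst : ∀ i j q, Γ (j, i) q = -Γ (i, j) q)
    (hsnd : ∀ p k l, Γ p (l, k) = -Γ p (k, l)) :
    ∑ p : Λ, ∑ q : Λ, Γ (orb p 1, orb q 0) (orb q 1, orb p 0) =
      ∑ x : Λ, ∑ y : Λ, Γ (orb x 0, orb y 1) (orb y 0, orb x 1) := by
  rw [Finset.sum_comm]
  refine Finset.sum_congr rfl fun x _ => Finset.sum_congr rfl fun y _ => ?_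
  rw [hfst (orb x 0) (orb y 1) (orb x 1, orb y 0), hsnd (orb x 0, orb y 1) (orb y 0) (orb x 1),
    neg_neg]

end Identities

section Sector

variable {a b : ℕ} {γ : Matrix (Orb Λ) (Orb Λ) ℂ} {Γ : Matrix (Orb Λ × Orb Λ) (Orb Λ × Orb Λ) ℂ}

/-- **E3-form on the printed sector rows**: at every feasible point of the printed `S_z`-sector DQG
programme `(N_α, N_β) = (a, b)`, `Σ_{pq} G_{(pβ,pα),(qβ,qα)} = N_β − Σ_{xy} Γ_{(xα,yβ),(yα,xβ)}` — the
relaxation-level form of the tree's state-level sum rule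
`⟨ψ|Ŝ_−Ŝ_+|ψ⟩ + Σ_{xy} ²D^{xα,yβ}_{yα,xβ} = N_β` (`expect_spinMinus_spinPlus_add_sum_twoRDM`). -/
theorem sum_gMap_downUp_of_isDQGFeasibleSector (h : IsDQGFeasibleSector a b γ Γ) :
    ∑ p : Λ, ∑ q : Λ, gMap γ Γ (orb p 1, orb p 0) (orb q 1, orb q 0) =
      (b : ℂ) - ∑ x : Λ, ∑ y : Λ, Γ (orb x 0, orb y 1) (orb y 0, orb x 1) := by
  rw [sum_gMap_downUp_eq, h.trace_down, sum_exchange_downUp_eq h.dqg.swap_fst h.dqg.swap_snd]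

/-- **Flipped (`⟨Ŝ_+Ŝ_−⟩`) form on the printed sector rows**:
`Σ_{pq} G_{(pα,pβ),(qα,qβ)} = N_α − Σ_{xy} Γ_{(xα,yβ),(yα,xβ)}`; the difference of the two forms is
`N_α − N_β = 2M` (`[Ŝ_+, Ŝ_−] = 2Ŝ_z` at the level of abstract moments, F3.1 (a′)). -/
theorem sum_gMap_upDown_of_isDQGFeasibleSector (h : IsDQGFeasibleSector a b γ Γ) :
    ∑ p : Λ, ∑ q : Λ, gMap γ Γ (orb p 0, orb p 1) (orb q 0, orb q 1) =
      (a : ℂ) - ∑ x : Λ, ∑ y : Λ, Γ (orb x 0, orb y 1) (orb y 0, orb x 1) := by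
  rw [sum_gMap_upDown_eq, h.trace_up]

/-- **Theorem F3.3, identity part (print's row (98) IS the cell's E3 row).** If a sector-feasible pair
satisfies Mazziotti's `S`-representability row (98) with its printed value
`Σ_{xy} Γ_{(xα,yβ),(yα,xβ)} = N/2 + M² − S(S+1)` (`N = a + b`, `M = (a − b)/2`; `S` any number), then
the cell's E3 functional takes the value FORMAT-qcl1 §5 prescribes:
`Σ_{pq} G_{(pβ,pα),(qβ,qα)} = S(S+1) − M(M+1)`. -/
theorem sum_gMap_downUp_of_sRow (h : IsDQGFeasibleSector a b γ Γ) (S : ℂ)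
    (hS : ∑ x : Λ, ∑ y : Λ, Γ (orb x 0, orb y 1) (orb y 0, orb x 1) =
      ((a : ℂ) + b) / 2 + (((a : ℂ) - b) / 2) ^ 2 - S * (S + 1)) :
    ∑ p : Λ, ∑ q : Λ, gMap γ Γ (orb p 1, orb p 0) (orb q 1, orb q 0) =
      S * (S + 1) - ((a : ℂ) - b) / 2 * (((a : ℂ) - b) / 2 + 1) := by
  rw [sum_gMap_downUp_of_isDQGFeasibleSector h, hS]
  ring

/-- The flipped form under row (98): `Σ_{pq} G_{(pα,pβ),(qα,qβ)} = S(S+1) − M(M−1)` (F3.1 (a′)). -/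
theorem sum_gMap_upDown_of_sRow (h : IsDQGFeasibleSector a b γ Γ) (S : ℂ)
    (hS : ∑ x : Λ, ∑ y : Λ, Γ (orb x 0, orb y 1) (orb y 0, orb x 1) =
      ((a : ℂ) + b) / 2 + (((a : ℂ) - b) / 2) ^ 2 - S * (S + 1)) :
    ∑ p : Λ, ∑ q : Λ, gMap γ Γ (orb p 0, orb p 1) (orb q 0, orb q 1) =
      S * (S + 1) - ((a : ℂ) - b) / 2 * (((a : ℂ) - b) / 2 - 1) := by
  rw [sum_gMap_upDown_of_isDQGFeasibleSector h, hS]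
  ring

/-! ### §2 Maximal projection `M = S` (row (98) reads `X = N_β`) and its mirror `M = −S` (`X = N_α`) -/

/-- **F3.3 (`M = S`, E3).** For the MAXIMAL projection `M = S` the printed value of row (98) is
`N/2 + S² − S(S+1) = N/2 − M = N_β`; with it the cell's E3 functional vanishes:
`Σ_{pq} G_{(pβ,pα),(qβ,qα)} = 0` (`= S(S+1) − M(M+1)` with `M = S`). -/
theorem sum_gMap_downUp_eq_zero_of_exchange_eq_numDown (h : IsDQGFeasibleSector a b γ Γ)
    (hX : ∑ x : Λ, ∑ y : Λ, Γ (orb x 0, orb y 1) (orb y 0, orb x 1) = b) :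
    ∑ p : Λ, ∑ q : Λ, gMap γ Γ (orb p 1, orb p 0) (orb q 1, orb q 0) = 0 := by
  rw [sum_gMap_downUp_of_isDQGFeasibleSector h, hX, sub_self]

/-- **F3.3 (`M = S`, kernel, column form).** `G ⪰ 0` turns the zero form into a kernel vector: at every
feasible point of the printed sector programme with row (98) at `M = S`, `Σ_r G_{m,(rβ,rα)} = 0` for
every index `m` — `G(γ, Γ) v = 0` for the coefficient vector `v` of `Ŝ_+ = Σ_r a†_{rα} a_{rβ}` in the
`G`-members `(rβ, rα)`; not only at `N`-representable points. -/
theorem sum_gMap_col_downUp_eq_zero_of_exchange_eq_numDown (h : IsDQGFeasibleSector a b γ Γ)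
    (hX : ∑ x : Λ, ∑ y : Λ, Γ (orb x 0, orb y 1) (orb y 0, orb x 1) = b) (m : Orb Λ × Orb Λ) :
    ∑ r : Λ, gMap γ Γ m (orb r 1, orb r 0) = 0 :=
  sum_apply_family_eq_zero h.dqg.g_psd (fun r : Λ => (orb r 1, orb r 0))
    (sum_gMap_downUp_eq_zero_of_exchange_eq_numDown h hX) m

/-- **F3.3 (`M = S`, kernel, row form)**: `Σ_r G_{(rβ,rα),m} = 0` for every `m` (`v† G = 0`). -/
theorem sum_gMap_row_downUp_eq_zero_of_exchange_eq_numDown (h : IsDQGFeasibleSector a b γ Γ)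
    (hX : ∑ x : Λ, ∑ y : Λ, Γ (orb x 0, orb y 1) (orb y 0, orb x 1) = b) (m : Orb Λ × Orb Λ) :
    ∑ r : Λ, gMap γ Γ (orb r 1, orb r 0) m = 0 :=
  sum_family_apply_eq_zero h.dqg.g_psd (fun r : Λ => (orb r 1, orb r 0))
    (sum_gMap_downUp_eq_zero_of_exchange_eq_numDown h hX) m

/-- **F3.3 (`M = S`, rows) — the cell's E4a rows are IMPLIED by the printed programme.** At every
feasible point of the printed sector programme with row (98) at `M = S`, for all `p, q`:
`γ_{pβ,qβ} = Σ_r Γ_{(pβ,rα),(rβ,qα)}` — FORMAT-qcl1 §5 E4a, `ω(a†_{pβ} a_{qα} Ŝ_+) = 0` expanded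
(the `m = (pβ, qα)` component of `G v = 0`). -/
theorem e4a_of_exchange_eq_numDown (h : IsDQGFeasibleSector a b γ Γ)
    (hX : ∑ x : Λ, ∑ y : Λ, Γ (orb x 0, orb y 1) (orb y 0, orb x 1) = b) (p q : Λ) :
    γ (orb p 1) (orb q 1) = ∑ r : Λ, Γ (orb p 1, orb r 0) (orb r 1, orb q 0) := by
  have h0 := sum_gMap_col_downUp_eq_zero_of_exchange_eq_numDown h hX (orb p 1, orb q 0)
  simp only [gMap, orb_inj, and_true, Finset.sum_sub_distrib, Finset.sum_ite_eq, Finset.mem_univ,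
    if_true] at h0
  exact sub_eq_zero.mp h0

/-- **F3.3 (`M = S`, the other kernel components): the spin-flip sums vanish.** At every feasible
point of the printed sector programme with row (98) at `M = S`, for every row label `P` and every
`q`: `Σ_r Γ_{(P,rα),(rβ,qβ)} = 0` (the `m = (P, qβ)` components of `G v = 0`; each summand couples pair indices
of two different `S_z` charges — entries a two-body `S_z` selection rule sets to zero one by one;
the printed programme forces their SUMS to vanish without that rule). -/
theorem sum_two_flip_eq_zero_of_exchange_eq_numDown (h : IsDQGFeasibleSector a b γ Γ)
    (hX : ∑ x : Λ, ∑ y : Λ, Γ (orb x 0, orb y 1) (orb y 0, orb x 1) = b) (P : Orb Λ) (q : Λ) :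
    ∑ r : Λ, Γ (P, orb r 0) (orb r 1, orb q 1) = 0 := by
  have h0 := sum_gMap_col_downUp_eq_zero_of_exchange_eq_numDown h hX (P, orb q 1)
  have h10 : ¬ ((1 : Fin 2) = 0) := by decide
  simp only [gMap, orb_inj, h10, and_false, if_false, zero_sub, Finset.sum_neg_distrib,
    neg_eq_zero] at h0
  exact h0

/-- **Mirror (`M = −S`, E3 flipped).** For the MINIMAL projection `M = −S` row (98) reads
`X = N/2 + S² − S(S+1) = N/2 + M = N_α`; with it the `⟨Ŝ_+Ŝ_−⟩`-form vanishes,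
`Σ_{pq} G_{(pα,pβ),(qα,qβ)} = 0`. -/
theorem sum_gMap_upDown_eq_zero_of_exchange_eq_numUp (h : IsDQGFeasibleSector a b γ Γ)
    (hX : ∑ x : Λ, ∑ y : Λ, Γ (orb x 0, orb y 1) (orb y 0, orb x 1) = a) :
    ∑ p : Λ, ∑ q : Λ, gMap γ Γ (orb p 0, orb p 1) (orb q 0, orb q 1) = 0 := by
  rw [sum_gMap_upDown_of_isDQGFeasibleSector h, hX, sub_self]

/-- **Mirror (`M = −S`, kernel, column form)**: `Σ_r G_{m,(rα,rβ)} = 0` for every `m` (`G u = 0` for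
the coefficient vector `u` of `Ŝ_−` in the members `(rα, rβ)`). -/
theorem sum_gMap_col_upDown_eq_zero_of_exchange_eq_numUp (h : IsDQGFeasibleSector a b γ Γ)
    (hX : ∑ x : Λ, ∑ y : Λ, Γ (orb x 0, orb y 1) (orb y 0, orb x 1) = a) (m : Orb Λ × Orb Λ) :
    ∑ r : Λ, gMap γ Γ m (orb r 0, orb r 1) = 0 :=
  sum_apply_family_eq_zero h.dqg.g_psd (fun r : Λ => (orb r 0, orb r 1))
    (sum_gMap_upDown_eq_zero_of_exchange_eq_numUp h hX) m

/-- **Mirror (`M = −S`, kernel, row form)**: `Σ_r G_{(rα,rβ),m} = 0` for every `m` (`u† G = 0`). -/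
theorem sum_gMap_row_upDown_eq_zero_of_exchange_eq_numUp (h : IsDQGFeasibleSector a b γ Γ)
    (hX : ∑ x : Λ, ∑ y : Λ, Γ (orb x 0, orb y 1) (orb y 0, orb x 1) = a) (m : Orb Λ × Orb Λ) :
    ∑ r : Λ, gMap γ Γ (orb r 0, orb r 1) m = 0 :=
  sum_family_apply_eq_zero h.dqg.g_psd (fun r : Λ => (orb r 0, orb r 1))
    (sum_gMap_upDown_eq_zero_of_exchange_eq_numUp h hX) m

/-- **Mirror (`M = −S`, rows) — FORMAT's E4b shape.** At every feasible point of the printed sector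
programme with row (98) at `M = −S`, for all `p, q`: `γ_{pα,qα} = Σ_r Γ_{(rα,pβ),(qα,rβ)}` —
FORMAT-qcl1 §5 E4b, `ω(Ŝ_+ a†_{pβ} a_{qα}) = Σ_r ω(a†_{rα} a_{rβ} a†_{pβ} a_{qα}) = 0` expanded
(the `(qα, pβ)` component of `u† G = 0`). -/
theorem e4b_of_exchange_eq_numUp (h : IsDQGFeasibleSector a b γ Γ)
    (hX : ∑ x : Λ, ∑ y : Λ, Γ (orb x 0, orb y 1) (orb y 0, orb x 1) = a) (p q : Λ) :
    γ (orb p 0) (orb q 0) = ∑ r : Λ, Γ (orb r 0, orb p 1) (orb q 0, orb r 1) := by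
  have h0 := sum_gMap_row_upDown_eq_zero_of_exchange_eq_numUp h hX (orb q 0, orb p 1)
  simp only [gMap, orb_inj, and_true, Finset.sum_sub_distrib, Finset.sum_ite_eq', Finset.mem_univ,
    if_true] at h0
  exact sub_eq_zero.mp h0

/-- **Mirror (`M = −S`, the other kernel components)**: `Σ_r Γ_{(P,rβ),(rα,qα)} = 0` for every row
label `P` and every `q`. -/
theorem sum_two_flip_eq_zero_of_exchange_eq_numUp (h : IsDQGFeasibleSector a b γ Γ)
    (hX : ∑ x : Λ, ∑ y : Λ, Γ (orb x 0, orb y 1) (orb y 0, orb x 1) = a) (P : Orb Λ) (q : Λ) :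
    ∑ r : Λ, Γ (P, orb r 1) (orb r 0, orb q 0) = 0 := by
  have h0 := sum_gMap_col_upDown_eq_zero_of_exchange_eq_numUp h hX (P, orb q 0)
  have h01 : ¬ ((0 : Fin 2) = 1) := by decide
  simp only [gMap, orb_inj, h01, and_false, if_false, zero_sub, Finset.sum_neg_distrib,
    neg_eq_zero] at h0
  exact h0

end Sector

end Summit.Ventures.CertifiedQuantumChemistry

end
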